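import Summits.AtomisticToContinuum.FouriersLaw.Theorems.EmbeddedDrudeMourreAbelThermodynamicLimitFixedHorizonMatching
import Summits.AtomisticToContinuum.FouriersLaw.Theorems.EmbeddedDrudeMourreAbelThermodynamicLimitCentralBondCurrentSecondMoments
import Summits.AtomisticToContinuum.FouriersLaw.Theorems.OddSectorIrreversibilitySubBallisticWindowStaticCurrentBound
import HarnessLib

/-!
# `stub_fixedFrequencyMatching` of line `series-law-at-every-laplace-frequency`, part 1:
the per-length bound on the open chain's current autocorrelation
(crux `LatticeLandauDamping.AbelThermodynamicLimit`, item stmt-AtomisticToContinuum-14013, `Iff.rfl`-identical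
to `EmbeddedDrudeMourre.AbelThermodynamicLimit`, stmt-AtomisticToContinuum-12596; `--supports` helper file
proving the registered helper stub `stub_perLengthCurrentAutocorrBound`, closes nothing)

The registered stub S3 `stub_fixedFrequencyMatching` asks, for the OPEN pinned anharmonic chain
`P = pinnedChain ω₂ lam β γ` (all parameters `> 0`) with both Langevin baths at `T > 0`, that the per-length
current resolvent form `F_N(ν)/N`, `F_N(ν) = ∫₀^∞ e^{-νt} c_N(t) dt`, converges to the closed chain's Abel
function `∫₀^∞ e^{-νt} C_T(t) dt` for regular witnesses. Here
`c_N(t) = ∫ J · (P_t J) dμ_{N,T}` is the equilibrium autocorrelation of the TOTAL bond current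
`J = Σ_i j_i` (Gibbs measure `gibbsMeasure N T`, constructed kernels `transitionKernel N T T t`).

This file (sorry-free) proves the `N`-UNIFORM PER-LENGTH BOUND that makes the dominated-convergence
reduction of S3 to fixed times possible (part 2):

* `|∫ f · P_u f dμ_T| ≤ ∫ f² dμ_T` for continuous observables of exponential class (weighted AM–GM and the
  `L²(μ_T)`-contraction of the Markov kernels leaving `μ_T` invariant), hence `|c_N(t)| ≤ ⟨J²⟩_{N,T}`;
* `⟨J²⟩_{N,T} = Σ_{i,k} ⟨j_i j_k⟩_{N,T}` with `⟨j_i j_k⟩_{N,T} = 0` for `|i - k| ≥ 2` (Gaussian momenta: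
  `integral_bondCurrent_mul_eq_zero`) and `⟨j_i j_k⟩ ≤ ½(⟨j_i²⟩ + ⟨j_k²⟩) ≤ M` with the `N`-uniform second
  moments `M` of `pinnedChain_integral_sq_bondCurrent_gibbsMeasure_le`; at most three `k` per `i`, so
  `⟨J²⟩_{N,T} ≤ 3MN`;
* `stub_perLengthCurrentAutocorrBound` (registered): `∃ B, ∀ N t, 0 ≤ t → |c_N(t)| ≤ B·N`;
* `t ↦ c_N(t)` is measurable (joint measurability of the kernels).

References: Cuneo–Eckmann–Hairer–Rey-Bellet 2018 (the kernels); Bonetto–Lebowitz–Rey-Bellet 2000 §7;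
Kundu–Dhar–Narayan 2009. No named fact is used; nothing here closes the item.
-/

noncomputable section

open MeasureTheory ProbabilityTheory Filter Topology Set Function
open scoped NNReal ENNReal

namespace Summit.AtomisticToContinuum.FouriersLaw.Theorems.AbelThermodynamicLimit.SeriesLawAtEveryLaplaceFrequency

open Literature.MathematicalPhysics.KineticTheory.HeatConduction
open Literature.MathematicalPhysics.KineticTheory OscillatorChain
open Summit.AtomisticToContinuum.FouriersLaw.Theorems.SubdiffusiveBondHeat
open Summit.AtomisticToContinuum.FouriersLaw.Theorems.LightConeBondHeat
open Summit.AtomisticToContinuum.FouriersLaw.Theorems.OddSectorIrreversibility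
open Summit.AtomisticToContinuum.FouriersLaw.Theorems.OddSectorIrreversibility.Corrector
open Summit.AtomisticToContinuum.FouriersLaw.Theorems.AbelThermodynamicLimit.LoomisCompactHorizonWitness
open Summit.AtomisticToContinuum.FouriersLaw.Theorems.SubBallisticWindow.StaticCurrentBound

variable {N : ℕ}

section FixedN

variable {ω₂ lam β γ : ℝ} (hω : 0 < ω₂) (hl : 0 ≤ lam) (hβ : 0 < β) (hγ : 0 < γ) (hN : 0 < N)
  {T : ℝ} (hT : 0 < T)
include hω hl hβ hγ hN hT

/-- **`|∫ f · P_u f dμ_T| ≤ ∫ f² dμ_T`** for a continuous observable `f` with `|f| ≤ C e^{ϑH}`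
(`0 < ϑ`, `2ϑ < 1/T`): weighted AM–GM `|f · P_u f| ≤ ½(f² + (P_u f)²)` under the integral and the
`L²(μ_T)`-contraction `∫ (P_u f)² dμ_T ≤ ∫ f² dμ_T` of the Markov kernels leaving `μ_T` invariant.
[folklore] -/
theorem pinnedChain_abs_integral_mul_act_self_le {ϑ C : ℝ} (hϑ0 : 0 < ϑ) (h2ϑ : 2 * ϑ < 1 / T)
    {f : PhaseSpace N → ℝ} (hf : Continuous f)
    (hfb : ∀ y, |f y| ≤ C * Real.exp (ϑ * (pinnedChain ω₂ lam β γ).hamiltonian N y)) (u : ℝ≥0) :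
    |∫ z, f z * (∫ y, f y ∂((pinnedChain ω₂ lam β γ).transitionKernel N T T u z))
      ∂((pinnedChain ω₂ lam β γ).gibbsMeasure N T)| ≤
      ∫ z, f z ^ 2 ∂((pinnedChain ω₂ lam β γ).gibbsMeasure N T) := by
  obtain ⟨hf2, hPf2, hle⟩ := pinnedChain_integral_sq_act_le hω hl hβ hγ hN hT hϑ0 h2ϑ hf hfb u
  have hprod := pinnedChain_integrable_mul_act hω hl hβ hγ hN hT hϑ0 h2ϑ hf hfb hf hfb u
  set P := pinnedChain ω₂ lam β γ with hP
  set μ := P.gibbsMeasure N T with hμ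
  have hpt : ∀ z, |f z * (∫ y, f y ∂(P.transitionKernel N T T u z))|
      ≤ (f z ^ 2 + (∫ y, f y ∂(P.transitionKernel N T T u z)) ^ 2) / 2 := by
    intro z
    set a : ℝ := f z
    set b : ℝ := ∫ y, f y ∂(P.transitionKernel N T T u z)
    rw [abs_mul]
    nlinarith [sq_nonneg (|a| - |b|), sq_abs a, sq_abs b, abs_nonneg a, abs_nonneg b]
  have h1 : |∫ z, f z * (∫ y, f y ∂(P.transitionKernel N T T u z)) ∂μ|
      ≤ ∫ z, |f z * (∫ y, f y ∂(P.transitionKernel N T T u z))| ∂μ :=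
    abs_integral_le_integral_abs
  have h2 : ∫ z, |f z * (∫ y, f y ∂(P.transitionKernel N T T u z))| ∂μ
      ≤ ∫ z, (f z ^ 2 + (∫ y, f y ∂(P.transitionKernel N T T u z)) ^ 2) / 2 ∂μ :=
    integral_mono hprod.abs ((hf2.add hPf2).div_const 2) hpt
  have h3 : ∫ z, (f z ^ 2 + (∫ y, f y ∂(P.transitionKernel N T T u z)) ^ 2) / 2 ∂μ =
      ((∫ z, f z ^ 2 ∂μ) + ∫ z, (∫ y, f y ∂(P.transitionKernel N T T u z)) ^ 2 ∂μ) / 2 := by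
    rw [integral_div, integral_add hf2 hPf2]
  linarith

/-- **`|c_N(t)| ≤ ⟨J²⟩_{N,T}`**: the equilibrium autocorrelation of the total bond current `J = Σ_i j_i`
(a continuous observable of exponential class, `|J| ≤ M e^{H/(4T)}`) is bounded, uniformly in `t`, by
its static second moment. [folklore] -/
theorem pinnedChain_abs_totalCurrentAutocorr_le_integral_sq (t : ℝ) :
    |∫ z, (∑ i : Fin N, (pinnedChain ω₂ lam β γ).bondCurrent N i z) *
        (∫ y, (∑ i : Fin N, (pinnedChain ω₂ lam β γ).bondCurrent N i y)
          ∂((pinnedChain ω₂ lam β γ).transitionKernel N T T t.toNNReal z))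
      ∂((pinnedChain ω₂ lam β γ).gibbsMeasure N T)| ≤
      ∫ z, (∑ i : Fin N, (pinnedChain ω₂ lam β γ).bondCurrent N i z) ^ 2
        ∂((pinnedChain ω₂ lam β γ).gibbsMeasure N T) := by
  obtain ⟨hϑ0, h2ϑ⟩ := quarter_inv_temp_admissible hT
  obtain ⟨M, -, hM⟩ := abs_totalBondCurrent_le_exp hω.le hl hβ.le γ N hϑ0
  exact pinnedChain_abs_integral_mul_act_self_le hω hl hβ hγ hN hT hϑ0 h2ϑ
    (continuous_totalBondCurrent ω₂ lam β γ N) hM t.toNNReal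

omit hγ hN in
/-- `j_i · j_k ∈ L¹(μ_T)` (polynomially bounded against the Gibbs weight). [folklore] -/
theorem pinnedChain_integrable_bondCurrent_mul_gibbsMeasure (i k : Fin N) :
    Integrable (fun z => (pinnedChain ω₂ lam β γ).bondCurrent N i z *
        (pinnedChain ω₂ lam β γ).bondCurrent N k z) ((pinnedChain ω₂ lam β γ).gibbsMeasure N T) :=
  (pinnedChain ω₂ lam β γ).integrable_gibbsMeasure (integrable_bondCurrent_mul hω hl hβ.le γ N hT i k)

omit hγ hN in
/-- **Distant bond currents are orthogonal in `L²(μ_{N,T})`**: `∫ j_i j_k dμ_{N,T} = 0` whenever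
`|i - k| ≥ 2` (the momenta are independent centred Gaussians under `μ_{N,T}` and `j_i j_k` is odd in
`p_k, p_{k+1}`; tree: `integral_bondCurrent_mul_eq_zero`). [folklore] -/
theorem pinnedChain_integral_bondCurrent_mul_gibbsMeasure_eq_zero {i k : Fin N}
    (hfar : i.val + 2 ≤ k.val ∨ k.val + 2 ≤ i.val) :
    ∫ z, (pinnedChain ω₂ lam β γ).bondCurrent N i z * (pinnedChain ω₂ lam β γ).bondCurrent N k z
      ∂((pinnedChain ω₂ lam β γ).gibbsMeasure N T) = 0 := by
  rw [(pinnedChain ω₂ lam β γ).integral_gibbsMeasure]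
  rcases hfar with h | h
  · rw [integral_bondCurrent_mul_eq_zero hω hl hβ.le γ N hT h, mul_zero]
  · have e : (fun x => (pinnedChain ω₂ lam β γ).bondCurrent N i x *
          (pinnedChain ω₂ lam β γ).bondCurrent N k x * (pinnedChain ω₂ lam β γ).gibbsDensity N T x) =
        fun x => (pinnedChain ω₂ lam β γ).bondCurrent N k x *
          (pinnedChain ω₂ lam β γ).bondCurrent N i x * (pinnedChain ω₂ lam β γ).gibbsDensity N T x := by
      funext x; ring
    rw [e, integral_bondCurrent_mul_eq_zero hω hl hβ.le γ N hT h, mul_zero]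

/-- **Near pairs**: `∫ j_i j_k dμ_{N,T} ≤ ½(⟨j_i²⟩_{N,T} + ⟨j_k²⟩_{N,T})` (`2ab ≤ a² + b²`). [folklore] -/
theorem pinnedChain_integral_bondCurrent_mul_gibbsMeasure_le (i k : Fin N) :
    ∫ z, (pinnedChain ω₂ lam β γ).bondCurrent N i z * (pinnedChain ω₂ lam β γ).bondCurrent N k z
      ∂((pinnedChain ω₂ lam β γ).gibbsMeasure N T) ≤
      ((∫ z, (pinnedChain ω₂ lam β γ).bondCurrent N i z ^ 2 ∂((pinnedChain ω₂ lam β γ).gibbsMeasure N T)) +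
        ∫ z, (pinnedChain ω₂ lam β γ).bondCurrent N k z ^ 2
          ∂((pinnedChain ω₂ lam β γ).gibbsMeasure N T)) / 2 := by
  have hi := pinnedChain_integrable_sq_bondCurrent hω hl hβ hγ hN hT i
  have hk := pinnedChain_integrable_sq_bondCurrent hω hl hβ hγ hN hT k
  have hik := pinnedChain_integrable_bondCurrent_mul_gibbsMeasure (γ := γ) hω hl hβ hT i k
  set P := pinnedChain ω₂ lam β γ with hP
  set μ := P.gibbsMeasure N T with hμ
  have hpt : ∀ z, P.bondCurrent N i z * P.bondCurrent N k z ≤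
      (P.bondCurrent N i z ^ 2 + P.bondCurrent N k z ^ 2) / 2 := by
    intro z
    set a : ℝ := P.bondCurrent N i z
    set b : ℝ := P.bondCurrent N k z
    nlinarith [sq_nonneg (a - b)]
  have h2 : ∫ z, P.bondCurrent N i z * P.bondCurrent N k z ∂μ ≤
      ∫ z, (P.bondCurrent N i z ^ 2 + P.bondCurrent N k z ^ 2) / 2 ∂μ :=
    integral_mono hik ((hi.add hk).div_const 2) hpt
  have h3 : ∫ z, (P.bondCurrent N i z ^ 2 + P.bondCurrent N k z ^ 2) / 2 ∂μ =
      ((∫ z, P.bondCurrent N i z ^ 2 ∂μ) + ∫ z, P.bondCurrent N k z ^ 2 ∂μ) / 2 := by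
    rw [integral_div, integral_add hi hk]
  linarith

/-- **`⟨J²⟩_{N,T} ≤ 3MN`**: expanding the square of `J = Σ_i j_i`, only the pairs `|i - k| ≤ 1` survive
(at most three `k` for each `i`), each bounded by the uniform second-moment bound `M`. [folklore] -/
theorem pinnedChain_integral_sq_totalCurrent_le {M : ℝ}
    (hM : ∀ k : Fin N, ∫ z, (pinnedChain ω₂ lam β γ).bondCurrent N k z ^ 2
      ∂((pinnedChain ω₂ lam β γ).gibbsMeasure N T) ≤ M) :
    ∫ z, (∑ i : Fin N, (pinnedChain ω₂ lam β γ).bondCurrent N i z) ^ 2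
        ∂((pinnedChain ω₂ lam β γ).gibbsMeasure N T) ≤ 3 * M * N := by
  have hint := pinnedChain_integrable_bondCurrent_mul_gibbsMeasure (γ := γ) hω hl hβ hT (N := N)
  have hnear := pinnedChain_integral_bondCurrent_mul_gibbsMeasure_le hω hl hβ hγ hN hT
  have hfar := fun i k : Fin N =>
    pinnedChain_integral_bondCurrent_mul_gibbsMeasure_eq_zero (γ := γ) hω hl hβ hT (N := N) (i := i) (k := k)
  set P := pinnedChain ω₂ lam β γ with hP
  set μ := P.gibbsMeasure N T with hμ
  have hM0 : 0 ≤ M := (integral_nonneg fun z => sq_nonneg _).trans (hM ⟨0, hN⟩)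
  -- expand the square and integrate termwise
  have hexp : ∫ z, (∑ i : Fin N, P.bondCurrent N i z) ^ 2 ∂μ =
      ∑ i : Fin N, ∑ k : Fin N, ∫ z, P.bondCurrent N i z * P.bondCurrent N k z ∂μ := by
    have e : ∀ z, (∑ i : Fin N, P.bondCurrent N i z) ^ 2 =
        ∑ i : Fin N, ∑ k : Fin N, P.bondCurrent N i z * P.bondCurrent N k z := fun z => by
      rw [sq, Finset.sum_mul_sum]
    simp_rw [e]
    rw [integral_finsetSum _ fun i _ => integrable_finsetSum _ fun k _ => hint i k]
    exact Finset.sum_congr rfl fun i _ => integral_finsetSum _ fun k _ => hint i k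
  -- each pair term is `≤ M` if `|i - k| ≤ 1` and vanishes otherwise
  have hterm : ∀ i k : Fin N, ∫ z, P.bondCurrent N i z * P.bondCurrent N k z ∂μ ≤
      if i.val ≤ k.val + 1 ∧ k.val ≤ i.val + 1 then M else 0 := by
    intro i k
    split_ifs with h
    · linarith [hnear i k, hM i, hM k]
    · exact (hfar i k (by omega)).le
  have hcard : ∀ i : Fin N,
      (Finset.univ.filter fun k : Fin N => i.val ≤ k.val + 1 ∧ k.val ≤ i.val + 1).card ≤ 3 := by
    intro i
    refine le_trans ?_ (Finset.card_le_three (a := i.val - 1) (b := i.val) (c := i.val + 1))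
    refine Finset.card_le_card_of_injOn (fun k : Fin N => k.val) (fun k hk => ?_) Fin.val_injective.injOn
    simp only [Finset.coe_filter, Finset.mem_univ, true_and, Set.mem_setOf_eq] at hk
    simp only [Finset.coe_insert, Finset.coe_singleton, Set.mem_insert_iff, Set.mem_singleton_iff]
    omega
  have hrow : ∀ i : Fin N, ∑ k : Fin N, ∫ z, P.bondCurrent N i z * P.bondCurrent N k z ∂μ ≤ 3 * M := by
    intro i
    calc ∑ k : Fin N, ∫ z, P.bondCurrent N i z * P.bondCurrent N k z ∂μ
        ≤ ∑ k : Fin N, (if i.val ≤ k.val + 1 ∧ k.val ≤ i.val + 1 then M else 0) :=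
          Finset.sum_le_sum fun k _ => hterm i k
      _ = ((Finset.univ.filter fun k : Fin N => i.val ≤ k.val + 1 ∧ k.val ≤ i.val + 1).card : ℝ) * M := by
          rw [← Finset.sum_filter, Finset.sum_const, nsmul_eq_mul]
      _ ≤ 3 * M := by
          have h3 : ((Finset.univ.filter fun k : Fin N =>
              i.val ≤ k.val + 1 ∧ k.val ≤ i.val + 1).card : ℝ) ≤ 3 := by
            exact_mod_cast hcard i
          exact mul_le_mul_of_nonneg_right h3 hM0
  rw [hexp]
  calc ∑ i : Fin N, ∑ k : Fin N, ∫ z, P.bondCurrent N i z * P.bondCurrent N k z ∂μ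
      ≤ ∑ _i : Fin N, 3 * M := Finset.sum_le_sum fun i _ => hrow i
    _ = 3 * M * N := by
        rw [Finset.sum_const, Finset.card_univ, Fintype.card_fin, nsmul_eq_mul]; ring

omit hN in
/-- `t ↦ c_N(t) = ∫ J · (P_{t⁺} J) dμ_{N,T}` is measurable (joint measurability of the constructed kernels
in `(t, z)`; tree: `pinnedChain_measurable_crossCorr`). [folklore] -/
theorem pinnedChain_measurable_totalCurrentAutocorr :
    Measurable fun t : ℝ => ∫ z, (∑ i : Fin N, (pinnedChain ω₂ lam β γ).bondCurrent N i z) *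
        (∫ y, (∑ i : Fin N, (pinnedChain ω₂ lam β γ).bondCurrent N i y)
          ∂((pinnedChain ω₂ lam β γ).transitionKernel N T T t.toNNReal z))
      ∂((pinnedChain ω₂ lam β γ).gibbsMeasure N T) :=
  pinnedChain_measurable_crossCorr hω hl hT (continuous_totalBondCurrent ω₂ lam β γ N)
    (continuous_totalBondCurrent ω₂ lam β γ N) hβ.le hγ.le

end FixedN

/-- **Per-length bound on the open chain's current autocorrelation** (parameter-point form): for
`P = pinnedChain ω₂ lam β γ` (all `> 0`) and `T > 0` there is `B ≥ 0` with `|c_N(t)| ≤ B·N` for ALL `N`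
and all `t` (`B = 3M`, `M` the `N`-uniform second-moment bound of the bond currents; `c_0 ≡ 0`).
[folklore] -/
theorem pinnedChain_abs_totalCurrentAutocorr_le_linear {ω₂ lam β γ : ℝ} (hω : 0 < ω₂) (hl : 0 < lam)
    (hβ : 0 < β) (hγ : 0 < γ) {T : ℝ} (hT : 0 < T) :
    ∃ B : ℝ, 0 ≤ B ∧ ∀ (N : ℕ) (t : ℝ),
      |∫ z, (∑ i : Fin N, (pinnedChain ω₂ lam β γ).bondCurrent N i z) *
          (∫ y, (∑ i : Fin N, (pinnedChain ω₂ lam β γ).bondCurrent N i y)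
            ∂((pinnedChain ω₂ lam β γ).transitionKernel N T T t.toNNReal z))
        ∂((pinnedChain ω₂ lam β γ).gibbsMeasure N T)| ≤ B * N := by
  obtain ⟨M, hM⟩ := pinnedChain_integral_sq_bondCurrent_gibbsMeasure_le (γ := γ) hω hl hβ hT
  have hM0 : 0 ≤ M := (integral_nonneg fun z => sq_nonneg _).trans (hM 1 0)
  refine ⟨3 * M, by positivity, fun N t => ?_⟩
  rcases Nat.eq_zero_or_pos N with rfl | hN
  · simp
  · exact (pinnedChain_abs_totalCurrentAutocorr_le_integral_sq hω hl.le hβ hγ hN hT t).trans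
      (pinnedChain_integral_sq_totalCurrent_le hω hl.le hβ hγ hN hT (hM N))

/-- **Registered helper stub `stub_perLengthCurrentAutocorrBound`** (reduction (a) of the registered stub
S3 `stub_fixedFrequencyMatching`, line series-law-at-every-laplace-frequency): for
`P = pinnedChain ω₂ lam β γ` (all `> 0`) and `T > 0` there is `B` with `|c_N(t)| ≤ B·N` for every `N` and
every `t ≥ 0`, where `c_N(t) = ∫ J · (P_t J) dμ_{N,T}` is the equilibrium autocorrelation of the total bond
current `J = Σ_i j_i` of the open `N`-chain (`⟨J, P_t J⟩ ≤ ‖J‖²_{L²(μ_{N,T})} ≤ 3MN`). [folklore] -/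
theorem stub_perLengthCurrentAutocorrBound :
    ∀ ω₂ lam β γ : ℝ, 0 < ω₂ → 0 < lam → 0 < β → 0 < γ → ∀ T : ℝ, 0 < T →
      ∃ B : ℝ, ∀ (N : ℕ) (t : ℝ), 0 ≤ t →
        |∫ z, (∑ i : Fin N, (Literature.MathematicalPhysics.KineticTheory.HeatConduction.pinnedChain
                ω₂ lam β γ).bondCurrent N i z) *
            (∫ y, (∑ i : Fin N, (Literature.MathematicalPhysics.KineticTheory.HeatConduction.pinnedChain
                ω₂ lam β γ).bondCurrent N i y)
              ∂((Literature.MathematicalPhysics.KineticTheory.HeatConduction.pinnedChain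
                ω₂ lam β γ).transitionKernel N T T t.toNNReal z))
          ∂((Literature.MathematicalPhysics.KineticTheory.HeatConduction.pinnedChain
                ω₂ lam β γ).gibbsMeasure N T)| ≤ B * (N : ℝ) := by
  intro ω₂ lam β γ hω hl hβ hγ T hT
  obtain ⟨B, -, hB⟩ := pinnedChain_abs_totalCurrentAutocorr_le_linear hω hl hβ hγ hT
  exact ⟨B, fun N t _ => hB N t⟩

end Summit.AtomisticToContinuum.FouriersLaw.Theorems.AbelThermodynamicLimit.SeriesLawAtEveryLaplaceFrequency

end
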